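import Mathlib
import HarnessLib
import Summits.Langlands.Langlands.Statement
import Literature.NumberTheory.EllipticCurves.NewformGaloisRep
import Literature.NumberTheory.GaloisRepresentations.FrobeniusDensity
import Literature.NumberTheory.Automorphic.ChebotarevArtinRepHolds
import Literature.RepresentationTheory.Semisimple.SubrepresentationEquiv

/-!
# `EisensteinProModularSeed` (stmt-Langlands-12920), line `descend-raise-basechange`, stub S2
# `stub_levelRaisedEisensteinNewformQ` — III. Chebotarev, change of frame, Satake, packaged steps

Support file (`--supports stmt-Langlands-12920`).  Everything here is PROVED (no named fact, no
definition):

* `forall_v_lt_one_of_frobenius` — a congruence `v (f σ) < 1` holding at the arithmetic Frobenius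
  elements outside a finite set of places holds on all of `Γ_ℚ` (`f` continuous): density of
  Frobenius elements (tree `absoluteGaloisGroup.frobenius_dense` fed by the PROVED
  `chebotarev_artinRep_holds`) and closedness of the open unit ball of `ℚ̄_p`;
* `isIrreducible_conj`, `hasFrobCharpolyAt_conj_iff` — invariance under change of frame;
* `satakeFrobCompatibleAt_of_newform` — the summit's `SatakeFrobCompatibleAt ι π ρ w` from a Satake
  parameter whose inverse roots cut out the Hecke polynomial and a `ρ` attached to the newform;
* `trace_det_congr_of_newform` (`tr ρ ≡ 1 + η`, `det ρ ≡ η` everywhere from the Eisenstein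
  congruences of the Hecke data), `eq_one_of_pow_eq_one_of_v_sub_one_lt` (Teichmüller rigidity),
  `apply_eq_one_of_conj_eq_diagonal` (the level step), `isLAlgebraic_isRegular_weight`.
[folklore]
-/

set_option linter.dupNamespace false -- project-wide option (lakefile weak.linter.dupNamespace); `Summit.Langlands.Langlands` is the mandated namespace

noncomputable section

namespace Summit.Langlands.Langlands.Theorems.SkinnerWilesDefectOne.EisensteinProModularSeed

open Literature.NumberTheory.GaloisRepresentations Literature.NumberTheory.Automorphic
open Literature.NumberTheory.EllipticCurves.ModularForms
open NumberField IsDedekindDomain IsLocalRing Field Polynomial Filter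
open scoped MatrixGroups Matrix
open CongruenceSubgroup UpperHalfPlane

section Density

variable {p : ℕ} [Fact p.Prime]

/-- On `ℚ̄_p`, `v x < 1` iff `‖x‖ < 1` (the valuation is the norm). [folklore] -/
theorem v_lt_one_iff_norm_lt_one (x : PadicAlgCl p) : Valued.v x < 1 ↔ ‖x‖ < 1 := by
  rw [PadicAlgCl.valuation_def, ← NNReal.coe_lt_coe, coe_nnnorm, NNReal.coe_one]

/-- **Congruences propagate from Frobenius elements to the whole Galois group** (Chebotarev:
Frobenius elements at the primes outside a finite set are dense in `Γ_ℚ`, tree theorem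
`absoluteGaloisGroup.frobenius_dense` fed by the proved `chebotarev_artinRep_holds`; and the
"open" unit ball of the non-archimedean field `ℚ̄_p` is closed).  If `f : Γ_ℚ → ℚ̄_p` is continuous
and `v (f σ) < 1` at every arithmetic Frobenius `σ` above every finite place outside the finite set
`S`, then `v (f σ) < 1` for every `σ ∈ Γ_ℚ`. [folklore] -/
theorem forall_v_lt_one_of_frobenius (f : absoluteGaloisGroup ℚ → PadicAlgCl p) (hf : Continuous f)
    (S : Set (HeightOneSpectrum (𝓞 ℚ))) (hS : S.Finite)
    (h : ∀ w ∉ S, ∀ 𝔓 ∈ w.primesAbove, ∀ σ : absoluteGaloisGroup ℚ, IsArithFrobAt (𝓞 ℚ) σ 𝔓 →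
      Valued.v (f σ) < 1)
    (σ : absoluteGaloisGroup ℚ) : Valued.v (f σ) < 1 := by
  have hD := absoluteGaloisGroup.frobenius_dense chebotarev_artinRep_holds ℚ S hS
  set U : Set (absoluteGaloisGroup ℚ) := f ⁻¹' Metric.ball 0 1 with hU
  have hUc : IsClosed U := (IsUltrametricDist.isClosed_ball (0 : PadicAlgCl p) 1).preimage hf
  have hsub : {σ : absoluteGaloisGroup ℚ |
      ∃ v ∉ S, ∃ 𝔓 ∈ v.primesAbove, IsArithFrobAt (𝓞 ℚ) σ 𝔓} ⊆ U := by
    rintro τ ⟨w, hw, 𝔓, h𝔓, hτ⟩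
    rw [hU, Set.mem_preimage, mem_ball_zero_iff, ← v_lt_one_iff_norm_lt_one]
    exact h w hw 𝔓 h𝔓 τ hτ
  have hall : U = Set.univ := by
    apply Set.eq_univ_of_univ_subset
    rw [← hD.closure_eq]
    exact closure_minimal hsub hUc
  have hσ : σ ∈ U := hall ▸ Set.mem_univ σ
  rw [hU, Set.mem_preimage, mem_ball_zero_iff, ← v_lt_one_iff_norm_lt_one] at hσ
  exact hσ

/-- The finite set of places of `ℚ` dividing a non-zero natural number. [folklore] -/
theorem finite_setOf_primesEquiv_dvd {n : ℕ} (hn : n ≠ 0) :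
    {w : HeightOneSpectrum (𝓞 ℚ) | ((Rat.HeightOneSpectrum.primesEquiv w : Nat.Primes) : ℕ) ∣ n}.Finite := by
  have hfin : {q : Nat.Primes | (q : ℕ) ∣ n}.Finite := by
    have : {q : Nat.Primes | (q : ℕ) ∣ n} ⊆ (fun q : Nat.Primes => (q : ℕ)) ⁻¹' (Finset.range (n + 1) : Set ℕ) := by
      intro q hq
      simp only [Set.mem_preimage, Finset.coe_range, Set.mem_Iio]
      exact Nat.lt_succ_of_le (Nat.le_of_dvd (Nat.pos_of_ne_zero hn) hq)
    exact Set.Finite.subset ((Finset.finite_toSet _).preimage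
      (Nat.Primes.coe_nat_injective.injOn)) this
  have hset : {w : HeightOneSpectrum (𝓞 ℚ) | ((Rat.HeightOneSpectrum.primesEquiv w : Nat.Primes) : ℕ) ∣ n} =
      Rat.HeightOneSpectrum.primesEquiv ⁻¹' {q : Nat.Primes | (q : ℕ) ∣ n} := rfl
  rw [hset]
  exact hfin.preimage Rat.HeightOneSpectrum.primesEquiv.injective.injOn

/-- `ℓ ∈ w ↔` the prime under `w` is `ℓ`. [folklore] -/
theorem natCast_mem_asIdeal_iff_primesEquiv (w : HeightOneSpectrum (𝓞 ℚ)) {ℓ : ℕ} (hℓ : ℓ.Prime) :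
    ((ℓ : ℕ) : 𝓞 ℚ) ∈ w.asIdeal ↔ ((Rat.HeightOneSpectrum.primesEquiv w : Nat.Primes) : ℕ) = ℓ := by
  change _ ↔ Rat.HeightOneSpectrum.natGenerator w = ℓ
  rw [← Nat.prime_dvd_prime_iff_eq (Rat.HeightOneSpectrum.prime_natGenerator w) hℓ,
    Rat.HeightOneSpectrum.natGenerator_dvd_iff,
    ← map_natCast (Rat.IsIntegralClosure.intEquiv (𝓞 ℚ)) ℓ, Ideal.apply_mem_of_equiv_iff]

end Density

section Conj

variable {G : Type*} [Group G] [TopologicalSpace G] {A : Type*} [Field A] [TopologicalSpace A]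
  [IsTopologicalRing A] {n : ℕ}

/-- Irreducibility of a framed representation is invariant under change of frame. [folklore] -/
theorem isIrreducible_conj (ρ : FramedRep G A n) (P : GL (Fin n) A) (h : ρ.IsIrreducible) :
    (FramedRep.conj P ρ).IsIrreducible := by
  let e : (Fin n → A) ≃ₗ[A] (Fin n → A) :=
    LinearEquiv.ofLinear (Matrix.toLin' (P : Matrix (Fin n) (Fin n) A))
      (Matrix.toLin' ((P⁻¹ : GL (Fin n) A) : Matrix (Fin n) (Fin n) A))
      (by rw [← Matrix.toLin'_mul, ← Units.val_mul, mul_inv_cancel, Units.val_one, Matrix.toLin'_one])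
      (by rw [← Matrix.toLin'_mul, ← Units.val_mul, inv_mul_cancel, Units.val_one, Matrix.toLin'_one])
  haveI : Representation.IsIrreducible (FramedRep.toRepresentation ρ) := h
  change Representation.IsIrreducible (FramedRep.toRepresentation (FramedRep.conj P ρ))
  refine Literature.RepresentationTheory.Semisimple.Representation.isIrreducible_of_equiv
    (ρ := FramedRep.toRepresentation ρ) (σ := FramedRep.toRepresentation (FramedRep.conj P ρ))
    (Representation.Equiv.mk e fun g => ?_)
  refine LinearMap.ext fun v => ?_
  change (P : Matrix (Fin n) (Fin n) A) *ᵥ (((ρ g : GL (Fin n) A) : Matrix (Fin n) (Fin n) A) *ᵥ v) =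
    ((FramedRep.conj P ρ g : GL (Fin n) A) : Matrix (Fin n) (Fin n) A) *ᵥ
      ((P : Matrix (Fin n) (Fin n) A) *ᵥ v)
  rw [FramedRep.conj_apply, Units.val_mul, Units.val_mul, Matrix.mulVec_mulVec, Matrix.mulVec_mulVec]
  congr 1
  rw [Matrix.mul_assoc ((P : Matrix (Fin n) (Fin n) A) * ((ρ g : GL (Fin n) A) : Matrix (Fin n) (Fin n) A)),
    Units.inv_mul, Matrix.mul_one]

end Conj

section FrobConj

variable {K : Type*} [Field K] {A : Type*} [CommRing A] [TopologicalSpace A]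
  [IsTopologicalRing A] {n : ℕ}

/-- Frobenius characteristic polynomials are invariant under change of frame. [folklore] -/
theorem hasFrobCharpolyAt_conj_iff (v : HeightOneSpectrum (𝓞 K)) (P : GL (Fin n) A)
    (ρ : FramedGaloisRep K A n) (Q : Polynomial A) :
    FramedGaloisRep.HasFrobCharpolyAt v Q (FramedRep.conj P ρ) ↔ ρ.HasFrobCharpolyAt v Q := by
  refine forall₂_congr fun 𝔓 _ => forall₂_congr fun σ _ => ?_
  have : FramedRep.charpoly (FramedRep.conj P ρ) σ = FramedRep.charpoly ρ σ := by
    unfold FramedRep.charpoly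
    rw [FramedRep.conj_apply, Units.val_mul, Units.val_mul, Matrix.coe_units_inv]
    exact Matrix.charpoly_units_conj P ((ρ σ : GL (Fin n) A) : Matrix (Fin n) (Fin n) A)
  rw [this]

end FrobConj

section SatakeGlue

variable {p : ℕ} [Fact p.Prime]

/-- **Satake–Frobenius compatibility of a newform's `π` and `ρ`**: if `π` has at `w` a Satake
parameter `α` with `∏ (X - a⁻¹) = X² - a_ℓ X + ε(ℓ) ℓ^{k-1}` and `ρ` is unramified at `w` with
Frobenius characteristic polynomial `ι⁻¹(X² - a_ℓ X + ε(ℓ) ℓ^{k-1})`, then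
`SatakeFrobCompatibleAt ι π ρ w` (the L-normalised clause of the summit statement). [folklore] -/
theorem satakeFrobCompatibleAt_of_newform {N : ℕ} [NeZero N] {k : ℤ} (g : CuspForm (Gamma1 N) k)
    (ι : PadicAlgCl p ≃+* ℂ) {hcpt : isCompact_glFiniteIntegralLevel 2 ℚ}
    (π : CuspidalAutomorphicRepData 2 ℚ hcpt) (ρ : FramedGaloisRep ℚ (PadicAlgCl p) 2)
    (w : HeightOneSpectrum (𝓞 ℚ)) (ℓ : ℕ) (α : Multiset ℂ) (hα : π.1.HasSatakeParamAt w α)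
    (hpoly : (α.map fun a => X - C a⁻¹).prod =
      X ^ 2 - C ((qExpansion 1 ⇑g).coeff ℓ) * X + C ((nebentypus g (ℓ : ZMod N) : ℂ) * (ℓ : ℂ) ^ (k - 1)))
    (hunr : ρ.IsUnramifiedAt w)
    (hfrob : ρ.HasFrobCharpolyAt w ((heckePolynomial g ℓ).map
      ((ι.symm : ℂ →+* PadicAlgCl p).comp (algebraMap (coeffCharField g) ℂ)))) :
    Summit.Langlands.SatakeFrobCompatibleAt ι π.1 ρ w := by
  refine ⟨α, hα, hunr, ?_⟩
  have hid : arithFrobPolyOfSatake ι w.residueCard 1 α =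
      (heckePolynomial g ℓ).map ((ι.symm : ℂ →+* PadicAlgCl p).comp (algebraMap (coeffCharField g) ℂ)) := by
    rw [arithFrobPolyOfSatake_one, ← Polynomial.map_map, map_heckePolynomial, ← hpoly,
      Polynomial.map_multiset_prod, Multiset.map_map]
    congr 1
    refine Multiset.map_congr rfl fun a _ => ?_
    simp [Polynomial.map_sub, Polynomial.map_X, Polynomial.map_C]
  rw [hid]
  exact hfrob

end SatakeGlue

/-! ### Three packaged steps of the main proof -/

section Steps

variable {p : ℕ} [hp : Fact p.Prime]

/-- Trace and determinant of a `2 × 2` matrix from its characteristic polynomial. [folklore] -/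
theorem trace_det_of_charpoly_eq {A : Type*} [CommRing A] [Nontrivial A] (Mx : Matrix (Fin 2) (Fin 2) A)
    (a d : A) (h : Mx.charpoly = X ^ 2 - C a * X + C d) : Mx.trace = a ∧ Mx.det = d := by
  rw [Matrix.charpoly_fin_two] at h
  have h1 := congrArg (fun f : A[X] => f.coeff 1) h
  have h0 := congrArg (fun f : A[X] => f.coeff 0) h
  simp only [coeff_add, coeff_sub, coeff_X_pow, coeff_C_mul, coeff_X_one, coeff_C_zero,
    coeff_X_zero, mul_one, mul_zero] at h1 h0
  norm_num at h1 h0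
  exact ⟨h1, h0⟩

/-- **`tr ρ ≡ 1 + η` and `det ρ ≡ η` on all of `Γ_ℚ`** for the representation `ρ` of a newform `g`
whose Hecke data are Eisenstein-congruent at the primes `ℓ ∤ Np` (Frobenius characteristic polynomials
from `IsGaloisRepOfNewform1`, then density of Frobenius elements). [folklore] -/
theorem trace_det_congr_of_newform :
    ∀ {p : ℕ} [Fact p.Prime] {N : ℕ} [NeZero N] {k : ℤ} (g : CuspForm (CongruenceSubgroup.Gamma1 N) k)
      (ι : PadicAlgCl p ≃+* ℂ) (ρ : Literature.NumberTheory.GaloisRepresentations.FramedGaloisRep ℚ (PadicAlgCl p) 2),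
      Literature.NumberTheory.EllipticCurves.ModularForms.IsGaloisRepOfNewform1 g
        ((ι.symm : ℂ →+* PadicAlgCl p).comp
          (algebraMap (Literature.NumberTheory.EllipticCurves.ModularForms.coeffCharField g) ℂ))
        {q | q ∣ N * p} ρ →
      ∀ (e : Field.absoluteGaloisGroup ℚ → PadicAlgCl p), Continuous e →
      (∀ ℓ : ℕ, ℓ.Prime → ¬ ℓ ∣ N → ℓ ≠ p →
        ∀ w : IsDedekindDomain.HeightOneSpectrum (NumberField.RingOfIntegers ℚ),
          (ℓ : NumberField.RingOfIntegers ℚ) ∈ w.asIdeal → ∀ 𝔓 ∈ w.primesAbove,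
          ∀ σ : Field.absoluteGaloisGroup ℚ, IsArithFrobAt (NumberField.RingOfIntegers ℚ) σ 𝔓 →
            Valued.v (ι.symm ((UpperHalfPlane.qExpansion 1 ⇑g).coeff ℓ) - (1 + e σ)) < 1 ∧
            Valued.v (ι.symm ((Literature.NumberTheory.EllipticCurves.ModularForms.nebentypus g (ℓ : ZMod N) : ℂ) *
              (ℓ : ℂ) ^ (k - 1)) - e σ) < 1) →
      (∀ σ, Valued.v (Matrix.trace (ρ σ).val - (1 + e σ)) < 1) ∧ (∀ σ, Valued.v ((ρ σ).val.det - e σ) < 1) := by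
  intro p hp N _ k g ι ρ hρg e he hcong
  set S : Set (HeightOneSpectrum (𝓞 ℚ)) :=
    {w | ((Rat.HeightOneSpectrum.primesEquiv w : Nat.Primes) : ℕ) ∣ N * p} with hS
  have hSfin : S.Finite := finite_setOf_primesEquiv_dvd (mul_ne_zero (NeZero.ne N) hp.out.ne_zero)
  have hfrob : ∀ w ∉ S, ∀ 𝔓 ∈ w.primesAbove, ∀ σ : absoluteGaloisGroup ℚ, IsArithFrobAt (𝓞 ℚ) σ 𝔓 →
      Valued.v (Matrix.trace (ρ σ).val - (1 + e σ)) < 1 ∧ Valued.v ((ρ σ).val.det - e σ) < 1 := by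
    intro w hw 𝔓 h𝔓 σ hσ
    set ℓ := ((Rat.HeightOneSpectrum.primesEquiv w : Nat.Primes) : ℕ) with hℓ
    have hprime : ℓ.Prime := (Rat.HeightOneSpectrum.primesEquiv w).2
    have hndvd : ¬ ℓ ∣ N * p := hw
    have hchar := (hρg w hndvd).2 𝔓 h𝔓 σ hσ
    unfold FramedRep.charpoly at hchar
    rw [← Polynomial.map_map, map_heckePolynomial, Polynomial.map_add, Polynomial.map_sub,
      Polynomial.map_mul, Polynomial.map_pow, Polynomial.map_X, Polynomial.map_C,
      Polynomial.map_C] at hchar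
    obtain ⟨htr, hdet⟩ := trace_det_of_charpoly_eq _ _ _ hchar
    obtain ⟨h1, h2⟩ := hcong ℓ hprime (fun h => hndvd (h.mul_right p))
      (fun h => hndvd (h ▸ dvd_mul_left p N)) w
      ((natCast_mem_asIdeal_iff_primesEquiv w hprime).mpr rfl) 𝔓 h𝔓 σ hσ
    exact ⟨by rw [htr]; exact h1, by rw [hdet]; exact h2⟩
  refine ⟨forall_v_lt_one_of_frobenius _ ?_ S hSfin (fun w hw 𝔓 h𝔓 σ hσ => (hfrob w hw 𝔓 h𝔓 σ hσ).1),
    forall_v_lt_one_of_frobenius _ ?_ S hSfin (fun w hw 𝔓 h𝔓 σ hσ => (hfrob w hw 𝔓 h𝔓 σ hσ).2)⟩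
  · exact (FramedRep.continuous_trace ρ).sub (continuous_const.add he)
  · have : Continuous fun σ => ((FramedRep.det ρ σ : (PadicAlgCl p)ˣ) : PadicAlgCl p) :=
      Units.continuous_val.comp (FramedRep.det ρ).continuous
    refine (this.congr fun σ => ?_).sub he
    rw [FramedRep.det_apply, Matrix.GeneralLinearGroup.val_det_apply]

/-- **Teichmüller rigidity**: a root of unity of order prime to `p` which is `≡ 1` modulo the
maximal ideal of `𝒪_{ℚ̄_p}` equals `1`. [folklore] -/
theorem eq_one_of_pow_eq_one_of_v_sub_one_lt {ζ : PadicAlgCl p} {m : ℕ} (hpm : ¬ p ∣ m)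
    (hζ : ζ ^ m = 1) (h1 : Valued.v (ζ - 1) < 1) : ζ = 1 := by
  have hvζ : Valued.v ζ = 1 := by
    have := Valuation.map_eq_of_sub_lt (Valued.v : Valuation (PadicAlgCl p) NNReal) (x := (1 : PadicAlgCl p)) (y := ζ) (by rwa [Valuation.map_one])
    rwa [Valuation.map_one] at this
  have hpow : ∀ i : ℕ, Valued.v (ζ ^ i - 1) < 1 := by
    intro i
    induction i with
    | zero => simp
    | succ n ih =>
      have : ζ ^ (n + 1) - 1 = ζ * (ζ ^ n - 1) + (ζ - 1) := by ring
      rw [this]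
      refine Valuation.map_add_lt _ ?_ h1
      rw [map_mul, hvζ, one_mul]
      exact ih
  have hsum : Valued.v ((Finset.range m).sum fun i => ζ ^ i) = 1 := by
    have hm1 : Valued.v ((m : ℕ) : PadicAlgCl p) = 1 := by
      rw [← map_natCast (algebraMap ℚ_[p] (PadicAlgCl p)), PadicAlgCl.valuation_def]
      ext
      rw [coe_nnnorm, NNReal.coe_one]
      change ‖((m : ℚ_[p]) : PadicAlgCl p)‖ = 1
      rw [PadicAlgCl.norm_extends, Padic.norm_natCast_eq_one_iff]
      exact (Nat.Prime.coprime_iff_not_dvd hp.out).mpr hpm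
    have hdiff : Valued.v ((Finset.range m).sum (fun i => ζ ^ i) - (m : PadicAlgCl p)) < 1 := by
      have : (Finset.range m).sum (fun i => ζ ^ i) - (m : PadicAlgCl p) =
          (Finset.range m).sum (fun i => ζ ^ i - 1) := by
        rw [Finset.sum_sub_distrib]; simp
      rw [this]
      exact Valuation.map_sum_lt _ one_ne_zero fun i _ => hpow i
    have := Valuation.map_eq_of_sub_lt (Valued.v : Valuation (PadicAlgCl p) NNReal) (x := (m : PadicAlgCl p)) (by rwa [hm1])
    rwa [hm1] at this
  have hne : (Finset.range m).sum (fun i => ζ ^ i) ≠ 0 := by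
    intro h0; rw [h0, Valuation.map_zero] at hsum; exact zero_ne_one hsum
  have hgeom := geom_sum_mul ζ m
  rw [hζ, sub_self, mul_eq_zero] at hgeom
  rcases hgeom with h | h
  · exact absurd h hne
  · exact sub_eq_zero.mp h

/-- `v x = 1` for `x ≡ 1`. [folklore] -/
theorem v_eq_one_of_sub_one_lt {x : PadicAlgCl p} (h : Valued.v (x - 1) < 1) : Valued.v x = 1 := by
  have := Valuation.map_eq_of_sub_lt (Valued.v : Valuation (PadicAlgCl p) NNReal) (x := (1 : PadicAlgCl p)) (y := x) (by rwa [Valuation.map_one])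
  rwa [Valuation.map_one] at this

/-- **The level step.**  If in some frame `ρ(σ) = diag(c, 1)` with `c` a root of unity of order prime
to `p`, and `tr ρ(σ) ≡ 1 + e` with `e ≡ 1`, then `c = 1` (Teichmüller rigidity) and `ρ(σ) = 1`. [folklore] -/
theorem apply_eq_one_of_conj_eq_diagonal {G : Type*} [Group G] [TopologicalSpace G]
    (ρ : FramedRep G (PadicAlgCl p) 2) (σ : G) (Q : GL (Fin 2) (PadicAlgCl p)) (c e : PadicAlgCl p)
    (ha : (Q⁻¹ * ρ σ * Q).val = !![c, 0; 0, 1])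
    (htr : Valued.v (Matrix.trace (ρ σ).val - (1 + e)) < 1) (he : Valued.v (e - 1) < 1)
    {m : ℕ} (hpm : ¬ p ∣ m) (hcm : c ^ m = 1) : ρ σ = 1 := by
  have htrconj : Matrix.trace (Q⁻¹ * ρ σ * Q).val = Matrix.trace (ρ σ).val := by
    rw [Units.val_mul, Units.val_mul]; exact Matrix.trace_units_conj' Q _
  rw [← htrconj, ha, Matrix.trace_fin_two] at htr
  simp only [Matrix.of_apply, Matrix.cons_val', Matrix.cons_val_zero, Matrix.cons_val_one,
    Matrix.cons_val_fin_one, Matrix.empty_val'] at htr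
  have hc1 : Valued.v (c - 1) < 1 := by
    have h2 := Valuation.map_add_lt _ htr he
    convert h2 using 2; ring
  have hc : c = 1 := eq_one_of_pow_eq_one_of_v_sub_one_lt hpm hcm hc1
  have hone : Q⁻¹ * ρ σ * Q = 1 := by
    apply Units.ext
    rw [ha, hc, Units.val_one]
    exact Matrix.one_fin_two.symm
  calc ρ σ = Q * (Q⁻¹ * ρ σ * Q) * Q⁻¹ := by group
    _ = 1 := by rw [hone, mul_one, mul_inv_cancel]

omit hp in
/-- The weight-`k` infinity type `{(k-1, 0), (0, k-1)}` is L-algebraic, and regular for `k ≠ 1`.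
[folklore] -/
theorem isLAlgebraic_isRegular_weight (k : ℤ) (hk : k ≠ 1) :
    InfinityType.IsLAlgebraic (K := ℚ) (n := 2) (fun _ =>
      ({⟨(k : ℂ) - 1, 0, ⟨k - 1, by push_cast; ring⟩⟩, ⟨0, (k : ℂ) - 1, ⟨1 - k, by push_cast; ring⟩⟩} :
        Multiset ArchWeight)) ∧
    InfinityType.IsRegular (K := ℚ) (n := 2) (fun _ =>
      ({⟨(k : ℂ) - 1, 0, ⟨k - 1, by push_cast; ring⟩⟩, ⟨0, (k : ℂ) - 1, ⟨1 - k, by push_cast; ring⟩⟩} :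
        Multiset ArchWeight)) := by
  constructor
  · intro σ q hq
    simp only [Multiset.insert_eq_cons, Multiset.mem_cons, Multiset.mem_singleton] at hq
    rcases hq with rfl | rfl
    · exact ⟨k - 1, 0, by push_cast; ring, by simp⟩
    · exact ⟨0, k - 1, by simp, by push_cast; ring⟩
  · intro σ
    simp only [Multiset.insert_eq_cons, Multiset.map_cons, Multiset.map_singleton, Multiset.nodup_cons,
      Multiset.mem_singleton, Multiset.nodup_singleton, and_true]
    have : ((k : ℂ) - 1) ≠ 0 := by
      rw [sub_ne_zero]; exact_mod_cast hk
    exact this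

end Steps

end Summit.Langlands.Langlands.Theorems.SkinnerWilesDefectOne.EisensteinProModularSeed
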